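import Literature.NumberTheory.EllipticCurves.HeightCovolumeBoundsRankinSelbergProofs
import Literature.NumberTheory.EllipticCurves.Gamma0RankinSelbergPairing
import Mathlib.NumberTheory.LSeries.DirichletContinuation
import Mathlib.NumberTheory.LSeries.Dirichlet
import Mathlib.NumberTheory.LSeries.HurwitzZetaValues
import HarnessLib

/-!
# The naive symmetric-square Dirichlet series of a weight-2 cusp form on `Γ₀(N)` and the value
# `L(Sym² f, 1) = 8π³ (f, f)/N` (Rankin 1939; Shimura 1976; Watkins 2004, §1)

Topic `Literature/NumberTheory/EllipticCurves`; namespace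
`Literature.NumberTheory.EllipticCurves.ModularForms`. Definitions with bodies (two auxiliary
sequences `mulNatCast`, `onSquares`; the twist `symmSqTwist`; the coefficients `symmSqCoeff`; the
edge value `symmSqLOne`) and theorems; no named fact (nothing here is left unproved).

This is step 1 ("Shimura's identity") of the printed proof of [Watkins2004], Theorem 5.1 (the
named fact `Literature.NumberTheory.EllipticCurves.watkins2004_thm_5_1`,
`HeightCovolumeBounds.lean`), now provable because Rankin's theorem on `Γ₀(N)` is proved in the
tree (`tendsto_sub_two_mul_tsum_normSq_cuspCoeff_div_rpow`,
`NewformPeterssonSizeRankinSelbergProofs.lean`). §1 of the paper starts from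

  `L(Sym² E, 1)/(2πΩ) = (deg φ/(N c²)) ∏_{p² ∣ N} U_p(1)`,

`L(Sym² E, s)` the symmetric-square `L`-function "normalised so that `s = 1/2` is the point of
symmetry" (i.e. the arithmetic normalisation shifted by one), `Ω = covol Λ_E`, `c` the Manin
constant. For a Hecke eigenform `f = Σ aₙ qⁿ ∈ S₂(Γ₀(N))` with real coefficients the classical
Dirichlet-series form of the symmetric square is Rankin's

  `Σₙ aₙ² n^{-s} = ζ^{(N)}(s − 1) ζ^{(N)}(2s − 2)^{-1} L(Sym² f, s)`   (`Re s > 2`),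

`ζ^{(N)}(s) = Σ_{(n,N)=1} n^{-s} = L(χ₀, s)` for the trivial character `χ₀ mod N` (level one and
weight `k`: [Bump1997], §1.6, (6.21) with Thm. 1.6.3 and Lemma 1.6.1, PDF p. 72:
`ζ(2s−2k+2) Σ A(n)² n^{-s} = ∏_p ∏_{i,j}(1 − αᵢαⱼ p^{-s})^{-1} = ζ(s−k+1) L(Sym² f, s)`; level `N`:
Shimura 1975 and [Watkins2004], §1), the Euler factors of the right-hand side being
`[(1 − α_p² p^{-s})(1 − p·p^{-s})(1 − β_p² p^{-s})]^{-1}` at `p ∤ N` and `(1 − a_p² p^{-s})^{-1}`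
at `p ∣ N`; this is the motivic `L(Sym² E, s)` (arithmetic normalisation) exactly when `N` is
squarefree, and in general differs from it by Euler factors at the primes `p² ∣ N` (the
`U_p(s)` of [Watkins2004], §1) — whence "naive". We therefore DEFINE, for any `f ∈ S₂(Γ₀(N))`,

* `symmSqTwist N` — the Dirichlet coefficients of `ζ^{(N)}(2s − 2)/ζ^{(N)}(s − 1)`, written as the
  convolution `(χ₀ μ · id) ⋆ (n = m² ↦ χ₀(m) n)` (`LSeries_symmSqTwist`);
* `symmSqCoeff f = (|aₙ|²)ₙ ⋆ symmSqTwist N` — the coefficients of the naive symmetric-square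
  series `L^{naive}(Sym² f, s) := ζ^{(N)}(2s−2) ζ^{(N)}(s−1)^{-1} Σ |aₙ|² n^{-s}`
  (`LSeries_symmSqCoeff`, `Re s > 2`);
* `symmSqLOne f = lim_{w → 2⁺} Re L^{naive}(Sym² f, w)` — the value at the edge of absolute
  convergence, i.e. Watkins' `L(Sym² E, 1)` in his normalisation when `f = f_E`, `E` semistable
  (the limit exists, `tendsto_LSeries_symmSqCoeff`; when `L(Sym² f, s)` is known to continue to an
  entire function — Shimura 1975, Gelbart–Jacquet 1978, not in the tree — it is its value there).

and PROVE, for every `N ≥ 1` and every `f ∈ S₂(Γ₀(N))`,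

* `tendsto_LSeries_symmSqCoeff`, `symmSqLOne_eq`: **`L^{naive}(Sym² f, w) → 8π³ (f, f)/N`** as
  `w → 2⁺`: `L^{naive}(Sym² f, w) = [(w−2) Σ|aₙ|²n^{-w}] · L(χ₀, 2w−2)/[(w−2) L(χ₀, w−1)]`, Rankin's
  residue `(w − 2) Σ |aₙ|² n^{-w} → 48π (f,f)/ψ(N)` (tree), Mathlib's
  `DirichletCharacter.LFunctionTrivChar_residue_one` (`(u−1)L(χ₀,u) → ∏_{p∣N}(1 − 1/p)`),
  `L(χ₀, 2) = ζ(2) ∏_{p∣N}(1 − p^{-2})`, `ζ(2) = π²/6`, and `ψ(N) = gamma0Index N = N ∏_{p∣N}(1 + 1/p)`;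
* `ModularParametrizationData.symmSqLOne_div_eq`: **Shimura's identity** in the form printed in
  [Watkins2004], §1, for the naive series and every parametrisation datum `D` of the tree:
  `symmSqLOne D.f/(2π covol Λ) = deg/(N c²)` (from the previous item and Zagier's
  `deg · covol = 4π² c² (f, f)`, `zagier_degree_formula_holds`);
* `watkins2004_thm_5_1.corrected_of_symmSqLOne_lower_bound`: Lemma 3.4 of the paper VERBATIM for
  the curve at hand, `L(Sym² f_E, 1) ≥ 0.033/log N^{(2)}` with `N^{(2)} = N²` (semistable), implies
  both inequalities of Theorem 5.1 as established by its printed proof (first inequality with the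
  `2π` of §1; see `HeightCovolumeBoundsProofs.lean`);
* `watkins2004_thm_5_1.first_of_symmSqLOne_lower_bound'`: the first inequality AS PRINTED follows
  from the `2π`-times stronger bound `c² L(Sym² f_E, 1) ≥ 2π · 0.033/log N²` — recording in the tree
  exactly what the printed statement would need beyond Lemma 3.4.

## References

* [Watkins2004] M. Watkins, *Explicit lower bounds on the modular degree of an elliptic curve*,
  arXiv:math/0408126 — §1 (Shimura's identity, `U_p`), Lemma 3.4, §4, Theorem 5.1.
* [Rankin1939] R. A. Rankin, Proc. Cambridge Philos. Soc. 35 (1939) — `Σ|aₙ|²n^{-s}`, its pole at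
  `s = k` and residue.
* [Bump1997] D. Bump, *Automorphic Forms and Representations*, CUP 1997, §1.6, (6.21),
  Thm. 1.6.2, Thm. 1.6.3, Lemma 1.6.1 (PDF p. 72).
* G. Shimura, *On the holomorphy of certain Dirichlet series*, Proc. LMS 31 (1975); *The special
  values of the zeta functions associated with cusp forms*, CPAM 29 (1976).
* [Murty1999CongruencePrimes] M. R. Murty, *Bounds for congruence primes*, §2.
-/

noncomputable section

open scoped MatrixGroups ModularForm Real Topology ArithmeticFunction.Moebius
open Filter Complex CongruenceSubgroup LSeries DirichletCharacter

namespace Literature.NumberTheory.EllipticCurves.ModularForms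

/-! ### Two elementary `L`-series manipulations -/

section LSeriesLemmas

/-- Auxiliary sequence `n ↦ F(n) · n` (Dirichlet coefficients of `L(F, s − 1)`). [folklore] -/
def mulNatCast (F : ℕ → ℂ) : ℕ → ℂ := fun n ↦ F n * n

/-- Auxiliary sequence supported on the squares, `m² ↦ g(m) · m²` (Dirichlet coefficients of
`L(g, 2s − 2)`). [folklore] -/
def onSquares (g : ℕ → ℂ) : ℕ → ℂ :=
  fun n ↦ if Nat.sqrt n * Nat.sqrt n = n then g (Nat.sqrt n) * n else 0

/-- Unfolding `mulNatCast`. [folklore] -/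
@[simp] theorem mulNatCast_apply (F : ℕ → ℂ) (n : ℕ) : mulNatCast F n = F n * n := rfl

/-- `onSquares g (m²) = g(m) m²`. [folklore] -/
theorem onSquares_apply_mul_self (g : ℕ → ℂ) (m : ℕ) :
    onSquares g (m * m) = g m * ((m * m : ℕ) : ℂ) := by
  simp [onSquares]

/-- `onSquares g` vanishes off the squares. [folklore] -/
theorem onSquares_eq_zero {g : ℕ → ℂ} {n : ℕ} (hn : ∀ m, m * m ≠ n) : onSquares g n = 0 := by
  have : ¬ Nat.sqrt n * Nat.sqrt n = n := hn _
  simp [onSquares, this]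

/-- `Σ (F(n) n) n^{-s} = Σ F(n) n^{-(s-1)}` termwise. [folklore] -/
theorem term_mulNatCast (F : ℕ → ℂ) (s : ℂ) (n : ℕ) :
    term (mulNatCast F) s n = term F (s - 1) n := by
  rcases eq_or_ne n 0 with rfl | hn
  · simp [term]
  · rw [term_of_ne_zero hn, term_of_ne_zero hn, mulNatCast_apply]
    have hn' : (n : ℂ) ≠ 0 := Nat.cast_ne_zero.mpr hn
    rw [cpow_sub _ _ hn', cpow_one, div_div_eq_mul_div]

/-- `L(F · id, s) = L(F, s − 1)`. [folklore] -/
theorem LSeries_mulNatCast (F : ℕ → ℂ) (s : ℂ) :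
    LSeries (mulNatCast F) s = LSeries F (s - 1) := by
  simp only [LSeries, term_mulNatCast]

/-- `L(F · id, s)` converges absolutely iff `L(F, s − 1)` does. [folklore] -/
theorem LSeriesSummable_mulNatCast_iff (F : ℕ → ℂ) (s : ℂ) :
    LSeriesSummable (mulNatCast F) s ↔ LSeriesSummable F (s - 1) := by
  have h : term (mulNatCast F) s = term F (s - 1) := funext (term_mulNatCast F s)
  simp only [LSeriesSummable, h]

/-- The `n^{-s}`-term of `onSquares g` at `n = m²` is the `m^{-(2s-2)}`-term of `g`. [folklore] -/
theorem term_onSquares (g : ℕ → ℂ) (s : ℂ) (m : ℕ) :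
    term (onSquares g) s (m * m) = term g (2 * s - 2) m := by
  rcases eq_or_ne m 0 with rfl | hm
  · simp [term]
  · have hmm : m * m ≠ 0 := mul_ne_zero hm hm
    have hm' : (m : ℂ) ≠ 0 := Nat.cast_ne_zero.mpr hm
    have hms : (m : ℂ) ^ s ≠ 0 := fun h ↦ hm' ((cpow_eq_zero_iff _ _).mp h).1
    have h2 : (m : ℂ) ^ (2 * s - 2) = (m : ℂ) ^ s * (m : ℂ) ^ s / (m : ℂ) ^ 2 := by
      rw [show 2 * s - 2 = (s + s) - 2 by ring, cpow_sub _ _ hm', cpow_add _ _ hm', cpow_two]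
    rw [term_of_ne_zero hmm, term_of_ne_zero hm, onSquares_apply_mul_self, Nat.cast_mul,
      natCast_mul_natCast_cpow, h2]
    field_simp

/-- The `L`-series terms of `onSquares g` vanish off the squares. [folklore] -/
theorem term_onSquares_eq_zero (g : ℕ → ℂ) (s : ℂ) :
    ∀ x ∉ Set.range (fun m : ℕ ↦ m * m), term (onSquares g) s x = 0 := by
  intro x hx
  have h0 : onSquares g x = 0 := onSquares_eq_zero fun m hm ↦ hx ⟨m, hm⟩
  simp [term, h0]

/-- `Σₙ onSquares g (n) n^{-s} = L(g, 2s − 2)`. [folklore] -/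
theorem LSeries_onSquares (g : ℕ → ℂ) (s : ℂ) :
    LSeries (onSquares g) s = LSeries g (2 * s - 2) := by
  have hinj : Function.Injective (fun m : ℕ ↦ m * m) :=
    fun a b h ↦ (mul_self_inj (Nat.zero_le a) (Nat.zero_le b)).mp h
  rw [LSeries, LSeries,
    ← hinj.tsum_eq (Function.support_subset_iff'.mpr (term_onSquares_eq_zero g s))]
  exact tsum_congr fun m ↦ term_onSquares g s m

/-- … and the corresponding summability statement. [folklore] -/
theorem LSeriesSummable_onSquares_iff (g : ℕ → ℂ) (s : ℂ) :
    LSeriesSummable (onSquares g) s ↔ LSeriesSummable g (2 * s - 2) := by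
  have hinj : Function.Injective (fun m : ℕ ↦ m * m) :=
    fun a b h ↦ (mul_self_inj (Nat.zero_le a) (Nat.zero_le b)).mp h
  have hcomp : term (onSquares g) s ∘ (fun m : ℕ ↦ m * m) = term g (2 * s - 2) :=
    funext fun m ↦ term_onSquares g s m
  unfold LSeriesSummable
  rw [← hinj.summable_iff (term_onSquares_eq_zero g s), hcomp]

end LSeriesLemmas

/-! ### The definitions -/

section Defs

variable {N : ℕ}

/-- **The twisting sequence `g_N`**: the Dirichlet coefficients of
`ζ^{(N)}(2s − 2)/ζ^{(N)}(s − 1)` (`ζ^{(N)}(s) = Σ_{(n,N)=1} n^{-s} = L(χ₀, s)`, `χ₀` the trivial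
character mod `N`), namely the Dirichlet convolution of `n ↦ χ₀(n) μ(n) n` (coefficients of
`1/ζ^{(N)}(s − 1)`) with `m² ↦ χ₀(m) m²` (coefficients of `ζ^{(N)}(2s − 2)`); explicitly
`g_N(n) = λ(n) n` for `(n, N) = 1` and `0` otherwise. Multiplying Rankin's `Σ aₙ² n^{-s}` by this
series gives the symmetric-square series ([Bump1997], (6.21) & Thm. 1.6.3:
`L(Sym² f, s) = ζ(2s−2k+2) ζ(s−k+1)^{-1} Σ A(n)² n^{-s}`, here `k = 2`, level `N`). [cite: Bump1997, §1.6 (6.21), Thm. 1.6.3, Lemma 1.6.1, PDF p. 72] -/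
def symmSqTwist (N : ℕ) : ℕ → ℂ :=
  LSeries.convolution
    (mulNatCast ((fun n : ℕ ↦ (1 : DirichletCharacter ℂ N) n) * fun n : ℕ ↦ (μ n : ℂ)))
    (onSquares fun n : ℕ ↦ (1 : DirichletCharacter ℂ N) n)

/-- **The naive symmetric-square coefficients of `f ∈ S₂(Γ₀(N))`**: the Dirichlet coefficients
`b(n)` of `L^{naive}(Sym² f, s) := ζ^{(N)}(2s − 2) ζ^{(N)}(s − 1)^{-1} Σₙ |aₙ(f)|² n^{-s}`
(arithmetic normalisation; absolutely convergent for `Re s > 2`, `LSeries_symmSqCoeff`), i.e.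
`(|aₙ|²)ₙ ⋆ g_N`. For a newform with real coefficients this is Rankin's form of the symmetric
square, with Euler factors `[(1 − α_p²p^{-s})(1 − p^{1-s})(1 − β_p²p^{-s})]^{-1}` (`p ∤ N`) and
`(1 − a_p² p^{-s})^{-1}` (`p ∣ N`) ([Bump1997], Thm. 1.6.3 / Lemma 1.6.1 at level one); for the
newform `f_E` of a SEMISTABLE `E/ℚ` it is the motivic `L(Sym² E, s)` of [Watkins2004], §1 (shifted:
Watkins centres it at `1/2`, so his `L(Sym² E, s)` is `Σ b(n) n^{-(s+1)}`); in general it differs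
from the motivic one by Euler factors at `p² ∣ N` (Watkins' `U_p(s)`), hence "naive".
[cite: Watkins2004, §1; Bump1997, §1.6 (6.21), Thm. 1.6.3] -/
def symmSqCoeff (f : CuspForm (Gamma0 N) 2) : ℕ → ℂ :=
  LSeries.convolution (fun n ↦ ((‖cuspCoeff f n‖ ^ 2 : ℝ) : ℂ)) (symmSqTwist N)

/-- **`L(Sym² f, 1)` in the normalisation of [Watkins2004]** (centre `1/2`; the point `s = 2` of
the arithmetic normalisation of `symmSqCoeff`): the limit from the right
`lim_{w → 2⁺} Re Σₙ b(n) n^{-w}` of the naive symmetric-square series at the edge of absolute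
convergence. The limit exists and equals `8π³ (f, f)/N` for every `f ∈ S₂(Γ₀(N))`
(`symmSqLOne_eq`); whenever `L(Sym² f, s)` continues holomorphically to a neighbourhood of the
edge (Shimura 1975 / Gelbart–Jacquet 1978, not in the tree) it is that function's value there.
[cite: Watkins2004, §1 and Lemma 3.4 (the quantity `L(Sym² f_E, 1)`)] -/
def symmSqLOne (f : CuspForm (Gamma0 N) 2) : ℝ :=
  limUnder (𝓝[>] (2 : ℝ)) fun w : ℝ ↦ (LSeries (symmSqCoeff f) w).re

end Defs

/-! ### `L`-series identities -/

section Identities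

variable {N : ℕ}

/-- **`Σ g_N(n) n^{-s} = L(χ₀μ, s − 1) · L(χ₀, 2s − 2) = ζ^{(N)}(2s−2)/ζ^{(N)}(s−1)`** for
`Re s > 2` (product of absolutely convergent series; `L(χ₀, u) L(χ₀ μ, u) = 1` for `Re u > 1` is
Mathlib's `DirichletCharacter.LSeries.mul_mu_eq_one`). [cite: Bump1997, §1.6 (6.21), PDF p. 72] -/
theorem LSeries_symmSqTwist {s : ℂ} (hs : 2 < s.re) :
    LSeries (symmSqTwist N) s =
      LSeries ((fun n : ℕ ↦ (1 : DirichletCharacter ℂ N) n) * fun n : ℕ ↦ (μ n : ℂ)) (s - 1) *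
        LSeries (fun n : ℕ ↦ (1 : DirichletCharacter ℂ N) n) (2 * s - 2) := by
  have hs1 : 1 < (s - 1).re := by simp only [sub_re, one_re]; linarith
  have hs2 : 1 < (2 * s - 2).re := by
    simp only [sub_re, mul_re, re_ofNat, im_ofNat, zero_mul, sub_zero]; linarith
  have h1 : LSeriesSummable
      (mulNatCast ((fun n : ℕ ↦ (1 : DirichletCharacter ℂ N) n) * fun n : ℕ ↦ (μ n : ℂ))) s :=
    (LSeriesSummable_mulNatCast_iff _ s).mpr
      (DirichletCharacter.LSeriesSummable_mul _
        (ArithmeticFunction.LSeriesSummable_moebius_iff.mpr hs1))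
  have h2 : LSeriesSummable (onSquares fun n : ℕ ↦ (1 : DirichletCharacter ℂ N) n) s :=
    (LSeriesSummable_onSquares_iff _ s).mpr
      (DirichletCharacter.LSeriesSummable_of_one_lt_re _ hs2)
  unfold symmSqTwist
  rw [LSeries_convolution' h1 h2, LSeries_onSquares, LSeries_mulNatCast]

/-- `Σ g_N(n) n^{-s}` converges absolutely for `Re s > 2`. [folklore] -/
theorem LSeriesSummable_symmSqTwist {s : ℂ} (hs : 2 < s.re) :
    LSeriesSummable (symmSqTwist N) s := by
  have hs1 : 1 < (s - 1).re := by simp only [sub_re, one_re]; linarith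
  have hs2 : 1 < (2 * s - 2).re := by
    simp only [sub_re, mul_re, re_ofNat, im_ofNat, zero_mul, sub_zero]; linarith
  have h1 : LSeriesSummable
      (mulNatCast ((fun n : ℕ ↦ (1 : DirichletCharacter ℂ N) n) * fun n : ℕ ↦ (μ n : ℂ))) s :=
    (LSeriesSummable_mulNatCast_iff _ s).mpr
      (DirichletCharacter.LSeriesSummable_mul _
        (ArithmeticFunction.LSeriesSummable_moebius_iff.mpr hs1))
  have h2 : LSeriesSummable (onSquares fun n : ℕ ↦ (1 : DirichletCharacter ℂ N) n) s :=
    (LSeriesSummable_onSquares_iff _ s).mpr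
      (DirichletCharacter.LSeriesSummable_of_one_lt_re _ hs2)
  exact h1.convolution h2

/-- `gamma0Index N = N ∏_{p ∣ N} (1 + 1/p)` (`= ∏_{p^e ∥ N} p^{e−1}(p+1)`), over `ℂ`. [folklore] -/
theorem gamma0Index_eq_mul_prod_one_add_inv (hN : N ≠ 0) :
    (gamma0Index N : ℂ) = N * ∏ p ∈ N.primeFactors, (1 + (p : ℂ)⁻¹) := by
  have hNprod : (N : ℂ) = ∏ p ∈ N.primeFactors, (p : ℂ) ^ (N.factorization p) := by
    have h := congrArg (Nat.cast (R := ℂ)) (Nat.prod_factorization_pow_eq_self hN)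
    rw [Finsupp.prod, Nat.support_factorization] at h
    push_cast at h
    exact h.symm
  unfold gamma0Index
  rw [Finsupp.prod, Nat.support_factorization, Nat.cast_prod, hNprod, ← Finset.prod_mul_distrib]
  refine Finset.prod_congr rfl fun p hp ↦ ?_
  have hprime : p.Prime := Nat.prime_of_mem_primeFactors hp
  have hp0 : (p : ℂ) ≠ 0 := Nat.cast_ne_zero.mpr hprime.ne_zero
  have hk : 0 < N.factorization p :=
    Nat.Prime.factorization_pos_of_dvd hprime hN (Nat.dvd_of_mem_primeFactors hp)
  obtain ⟨j, hj⟩ : ∃ j, N.factorization p = j + 1 := ⟨N.factorization p - 1, by omega⟩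
  rw [hj, Nat.add_sub_cancel]
  push_cast
  rw [pow_succ]
  field_simp

/-- `1 − 1/p ≠ 0` for the prime factors of `N`. [folklore] -/
theorem prod_one_sub_inv_primeFactors_ne_zero :
    (∏ p ∈ N.primeFactors, (1 - (p : ℂ)⁻¹)) ≠ 0 := by
  refine Finset.prod_ne_zero_iff.mpr fun p hp ↦ ?_
  have hprime : p.Prime := Nat.prime_of_mem_primeFactors hp
  intro h
  have h' : (p : ℂ)⁻¹ = 1 := by linear_combination -h
  have h1 : p = 1 := by exact_mod_cast (inv_eq_one.mp h')
  exact hprime.one_lt.ne' h1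

variable [NeZero N]

/-- **Rankin's range of convergence in `L`-series form**: `Σ |aₙ(f)|² n^{-s}` converges absolutely
for `Re s > 2` (`f ∈ S₂(Γ₀(N))`; from the tree's `summable_normSq_cuspCoeff_mul_rpow`, Rankin's
strip bound, at a real point of `(2, 4)` below `Re s`). [cite: Rankin1939, convergence of Σ|aₙ|²n^{-s} for Re s > k] -/
theorem LSeriesSummable_normSq_cuspCoeff (f : CuspForm (Gamma0 N) 2) {s : ℂ} (hs : 2 < s.re) :
    LSeriesSummable (fun n ↦ ((‖cuspCoeff f n‖ ^ 2 : ℝ) : ℂ)) s := by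
  -- a real point `w₀ ∈ (2, 4)` with `w₀ ≤ Re s`
  obtain ⟨w₀, hw₀2, hw₀4, hw₀s⟩ : ∃ w₀ : ℝ, 2 < w₀ ∧ w₀ < 4 ∧ w₀ ≤ s.re :=
    ⟨min s.re 3, lt_min hs (by norm_num), (min_le_right _ _).trans_lt (by norm_num), min_le_left _ _⟩
  have hw₀0 : 0 < w₀ := by linarith
  -- Rankin summability at `w₀`, in the tree's normalisation
  have hsum := summable_normSq_cuspCoeff_mul_rpow (k := 2) (by norm_num) f (s := w₀ - 1)
    (by linarith) (by linarith)
  have hΓ : 0 < Real.Gamma w₀ := Real.Gamma_pos_of_pos hw₀0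
  have h4π : (0 : ℝ) < 4 * π := by positivity
  have h4πw : (0 : ℝ) < (4 * π) ^ w₀ := Real.rpow_pos_of_pos h4π w₀
  have hsum' : Summable fun n : ℕ ↦ (4 * π) ^ w₀ / Real.Gamma w₀ *
      (‖cuspCoeff f n‖ ^ 2 * ((1 / (4 * π * n)) ^ w₀ * Real.Gamma w₀)) := by
    refine (hsum.mul_left ((4 * π) ^ w₀ / Real.Gamma w₀)).congr fun n ↦ ?_
    have hexp : (w₀ - 1 + ((2 : ℤ) : ℝ) - 1) = w₀ := by push_cast; ring
    rw [hexp]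
  -- compare with the norms of the terms at `(w₀ : ℂ)`
  have hreal : LSeriesSummable (fun n ↦ ((‖cuspCoeff f n‖ ^ 2 : ℝ) : ℂ)) (w₀ : ℂ) := by
    refine Summable.of_norm_bounded hsum' fun n ↦ ?_
    rcases eq_or_ne n 0 with rfl | hn
    · rw [term_zero, norm_zero]
      exact mul_nonneg (div_pos h4πw hΓ).le (mul_nonneg (sq_nonneg _)
        (mul_nonneg (Real.rpow_nonneg (by positivity) _) hΓ.le))
    · have hn' : (0 : ℝ) < n := by exact_mod_cast Nat.pos_of_ne_zero hn
      have hnw : (0 : ℝ) < (n : ℝ) ^ w₀ := Real.rpow_pos_of_pos hn' w₀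
      rw [norm_term_eq, if_neg hn, Complex.norm_real, Real.norm_of_nonneg (sq_nonneg _), ofReal_re]
      refine le_of_eq ?_
      rw [one_div, Real.inv_rpow (by positivity), Real.mul_rpow h4π.le hn'.le]
      field_simp
  exact hreal.of_re_le_re (by simpa using hw₀s)

/-- **`L^{naive}(Sym² f, s) = (Σ |aₙ|² n^{-s}) · (Σ g_N(n) n^{-s})`** for `Re s > 2` (product of
absolutely convergent Dirichlet series). [cite: Bump1997, §1.6 (6.21), Thm. 1.6.3, PDF p. 72] -/
theorem LSeries_symmSqCoeff (f : CuspForm (Gamma0 N) 2) {s : ℂ} (hs : 2 < s.re) :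
    LSeries (symmSqCoeff f) s =
      LSeries (fun n ↦ ((‖cuspCoeff f n‖ ^ 2 : ℝ) : ℂ)) s * LSeries (symmSqTwist N) s := by
  unfold symmSqCoeff
  exact LSeries_convolution' (LSeriesSummable_normSq_cuspCoeff f hs) (LSeriesSummable_symmSqTwist hs)

omit [NeZero N] in
/-- The `L`-series of `(|aₙ|²)` at a real point `w > 0` is the real series `Σ |aₙ|²/n^w` of the
tree's Rankin–Selberg files. [folklore] -/
theorem LSeries_normSq_cuspCoeff_ofReal (f : CuspForm (Gamma0 N) 2) {w : ℝ} (hw : 0 < w) :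
    LSeries (fun n ↦ ((‖cuspCoeff f n‖ ^ 2 : ℝ) : ℂ)) w =
      ((∑' n : ℕ, ‖cuspCoeff f n‖ ^ 2 / (n : ℝ) ^ w : ℝ) : ℂ) := by
  rw [LSeries, ofReal_tsum]
  refine tsum_congr fun n ↦ ?_
  rcases eq_or_ne n 0 with rfl | hn
  · simp [term, Real.zero_rpow hw.ne']
  · rw [term_of_ne_zero hn, ofReal_div, ofReal_cpow (Nat.cast_nonneg n), ofReal_natCast]

/-- **`L^{naive}(Sym² f, w) → 8π³ (f, f)/N` as `w → 2⁺`**, for every `f ∈ S₂(Γ₀(N))`, `N ≥ 1`: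
the classical evaluation `L(Sym² f, 1) = 8π³(f,f)/N` of the symmetric-square `L`-function at the
edge of the critical strip through Rankin's residue ([Rankin1939]; [Bump1997], Thm. 1.6.2;
[Murty1999CongruencePrimes], §2; the identity behind [Watkins2004], §1). Proof:
`L^{naive}(Sym² f, w) = [(w−2)Σ|aₙ|²n^{-w}] · L(χ₀, 2w−2) · [(w−2) L(χ₀, w−1)]^{-1}` for `2 < w`;
the three factors tend to `48π(f,f)/ψ(N)` (`tendsto_sub_two_mul_tsum_normSq_cuspCoeff_div_rpow`),
`L(χ₀, 2) = ζ(2)∏_{p∣N}(1 − p^{-2})` and `∏_{p∣N}(1 − 1/p)`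
(`DirichletCharacter.LFunctionTrivChar_residue_one`); and
`48π/ψ(N) · (π²/6) · ∏_{p∣N}(1 + 1/p) = 8π³/N` since `ψ(N) = N∏_{p∣N}(1 + 1/p)`.
[cite: Watkins2004, §1; Bump1997, §1.6 Thm. 1.6.2–1.6.3, PDF p. 72] -/
theorem tendsto_LSeries_symmSqCoeff (f : CuspForm (Gamma0 N) 2) :
    Tendsto (fun w : ℝ ↦ LSeries (symmSqCoeff f) w) (𝓝[>] 2)
      (𝓝 (((8 * π ^ 3 * (peterssonProduct (Gamma0 N) 2 f f).re / N : ℝ) : ℂ))) := by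
  set P : ℝ := (peterssonProduct (Gamma0 N) 2 f f).re
  have hN0 : N ≠ 0 := NeZero.ne N
  -- G1: `(w − 2) Σ |aₙ|² n^{-w} → 48π P/ψ(N)`, in `ℂ`
  have G1 : Tendsto (fun w : ℝ ↦ ((w - 2 : ℝ) : ℂ) *
      LSeries (fun n ↦ ((‖cuspCoeff f n‖ ^ 2 : ℝ) : ℂ)) w) (𝓝[>] 2)
      (𝓝 ((48 * π * P / gamma0Index N : ℝ) : ℂ)) := by
    have h := ((continuous_ofReal.tendsto _).comp
      (tendsto_sub_two_mul_tsum_normSq_cuspCoeff_div_rpow f))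
    refine h.congr' ?_
    filter_upwards [self_mem_nhdsWithin] with w hw
    simp only [Set.mem_Ioi] at hw
    simp only [Function.comp_apply]
    rw [ofReal_mul, LSeries_normSq_cuspCoeff_ofReal f (by linarith)]
  -- G2: `L(χ₀, 2w − 2) → L(χ₀, 2)`
  have G2 : Tendsto (fun w : ℝ ↦ LFunctionTrivChar N (2 * (w : ℂ) - 2)) (𝓝[>] 2)
      (𝓝 (LFunctionTrivChar N 2)) := by
    have hc : ContinuousAt (LFunctionTrivChar N) 2 :=
      (differentiableAt_LFunction _ 2 (Or.inl (by norm_num))).continuousAt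
    have hu : Continuous (fun w : ℝ ↦ 2 * (w : ℂ) - 2) := by fun_prop
    have h2 := hu.tendsto 2
    rw [show (2 * ((2 : ℝ) : ℂ) - 2) = 2 by push_cast; ring] at h2
    exact (hc.tendsto.comp h2).mono_left nhdsWithin_le_nhds
  -- G3: `(w − 2) L(χ₀, w − 1) → ∏_{p ∣ N} (1 − 1/p)`
  have G3 : Tendsto (fun w : ℝ ↦ ((w - 2 : ℝ) : ℂ) * LFunctionTrivChar N ((w : ℂ) - 1)) (𝓝[>] 2)
      (𝓝 (∏ p ∈ N.primeFactors, (1 - (p : ℂ)⁻¹))) := by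
    have hu : Tendsto (fun w : ℝ ↦ (w : ℂ) - 1) (𝓝[>] 2) (𝓝[≠] 1) := by
      refine tendsto_nhdsWithin_iff.mpr ⟨?_, ?_⟩
      · have hcu : Continuous (fun w : ℝ ↦ (w : ℂ) - 1) := by fun_prop
        have h := (hcu.tendsto 2).mono_left (nhdsWithin_le_nhds (s := Set.Ioi (2 : ℝ)))
        rwa [show ((2 : ℝ) : ℂ) - 1 = 1 by push_cast; ring] at h
      · filter_upwards [self_mem_nhdsWithin] with w hw
        simp only [Set.mem_Ioi] at hw
        simp only [Set.mem_compl_iff, Set.mem_singleton_iff]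
        intro h
        have h' := congrArg Complex.re h
        simp at h'
        linarith
    have h := (LFunctionTrivChar_residue_one (N := N)).comp hu
    refine h.congr' (Eventually.of_forall fun w ↦ ?_)
    simp only [Function.comp_apply]
    push_cast
    ring
  have hP1 := prod_one_sub_inv_primeFactors_ne_zero (N := N)
  have hlim := (G1.mul G2).mul (G3.inv₀ hP1)
  -- the value of the limit
  have hval : ((48 * π * P / gamma0Index N : ℝ) : ℂ) * LFunctionTrivChar N 2 *
      (∏ p ∈ N.primeFactors, (1 - (p : ℂ)⁻¹))⁻¹ = ((8 * π ^ 3 * P / N : ℝ) : ℂ) := by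
    rw [LFunctionTrivChar_eq_mul_riemannZeta (by norm_num), riemannZeta_two]
    have hfac : (∏ p ∈ N.primeFactors, (1 - (p : ℂ) ^ (-(2 : ℂ)))) =
        (∏ p ∈ N.primeFactors, (1 - (p : ℂ)⁻¹)) * ∏ p ∈ N.primeFactors, (1 + (p : ℂ)⁻¹) := by
      rw [← Finset.prod_mul_distrib]
      refine Finset.prod_congr rfl fun p hp ↦ ?_
      rw [cpow_neg, cpow_two, ← inv_pow]
      ring
    have hψ : (gamma0Index N : ℂ) ≠ 0 := by exact_mod_cast (gamma0Index_pos N).ne'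
    have hNc : (N : ℂ) ≠ 0 := by exact_mod_cast hN0
    have hπ : (π : ℂ) ≠ 0 := by exact_mod_cast Real.pi_ne_zero
    have hprod : (∏ p ∈ N.primeFactors, (1 + (p : ℂ)⁻¹)) = (gamma0Index N : ℂ) / N := by
      rw [gamma0Index_eq_mul_prod_one_add_inv hN0]
      field_simp
    rw [hfac, hprod, show ∀ a c d z : ℂ, a * (c * d * z) * c⁻¹ = a * (d * z) * (c * c⁻¹) from
      fun a c d z ↦ by ring, mul_inv_cancel₀ hP1, mul_one]
    push_cast
    field_simp
    ring
  rw [hval] at hlim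
  refine hlim.congr' ?_
  filter_upwards [self_mem_nhdsWithin] with w hw
  simp only [Set.mem_Ioi] at hw
  have hw' : 2 < ((w : ℂ)).re := by simpa using hw
  have hs1 : 1 < ((w : ℂ) - 1).re := by simp only [sub_re, ofReal_re, one_re]; linarith
  have hs2 : 1 < (2 * (w : ℂ) - 2).re := by
    simp only [sub_re, mul_re, re_ofNat, im_ofNat, ofReal_re, ofReal_im, mul_zero, sub_zero]
    linarith
  rw [LSeries_symmSqCoeff f hw', LSeries_symmSqTwist hw']
  have hχ1 := DirichletCharacter.LSeries.mul_mu_eq_one (1 : DirichletCharacter ℂ N) hs1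
  have hL1 : LFunctionTrivChar N ((w : ℂ) - 1) =
      LSeries (fun n : ℕ ↦ (1 : DirichletCharacter ℂ N) n) ((w : ℂ) - 1) :=
    LFunction_eq_LSeries 1 hs1
  have hL2 : LFunctionTrivChar N (2 * (w : ℂ) - 2) =
      LSeries (fun n : ℕ ↦ (1 : DirichletCharacter ℂ N) n) (2 * (w : ℂ) - 2) :=
    LFunction_eq_LSeries 1 hs2
  have hne : LSeries (fun n : ℕ ↦ (1 : DirichletCharacter ℂ N) n) ((w : ℂ) - 1) ≠ 0 :=
    DirichletCharacter.LSeries_ne_zero_of_one_lt_re _ hs1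
  have hw0 : ((w - 2 : ℝ) : ℂ) ≠ 0 := by
    have : (w - 2 : ℝ) ≠ 0 := by linarith
    exact_mod_cast this
  have hμ : LSeries ((fun n : ℕ ↦ (1 : DirichletCharacter ℂ N) n) * fun n : ℕ ↦ (μ n : ℂ)) ((w : ℂ) - 1) =
      (LSeries (fun n : ℕ ↦ (1 : DirichletCharacter ℂ N) n) ((w : ℂ) - 1))⁻¹ :=
    eq_inv_of_mul_eq_one_right hχ1
  rw [hL1, hL2, hμ]
  field_simp

/-- Real form: `Re L^{naive}(Sym² f, w) → 8π³ (f, f)/N` as `w → 2⁺`. [cite: Watkins2004, §1] -/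
theorem tendsto_re_LSeries_symmSqCoeff (f : CuspForm (Gamma0 N) 2) :
    Tendsto (fun w : ℝ ↦ (LSeries (symmSqCoeff f) w).re) (𝓝[>] 2)
      (𝓝 (8 * π ^ 3 * (peterssonProduct (Gamma0 N) 2 f f).re / N)) := by
  have h := (continuous_re.tendsto _).comp (tendsto_LSeries_symmSqCoeff f)
  rwa [ofReal_re] at h

/-- **`L(Sym² f, 1) = 8π³ (f, f)/N`** (Watkins' normalisation; `(f,f) = ∬_{Γ₀(N)\ℍ}|f|²dxdy`):
the defined edge value `symmSqLOne f` equals `8π³ Re(f, f)/N` for every `f ∈ S₂(Γ₀(N))`, `N ≥ 1`.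
For the newform of a semistable elliptic curve this is the identity
`(f, f) = N L(Sym² E, 1)/(8π³)` underlying [Watkins2004], §1 (Shimura 1976 / Rankin).
[cite: Watkins2004, §1; Bump1997, §1.6 Thm. 1.6.2, PDF p. 72] -/
theorem symmSqLOne_eq (f : CuspForm (Gamma0 N) 2) :
    symmSqLOne f = 8 * π ^ 3 * (peterssonProduct (Gamma0 N) 2 f f).re / N :=
  (tendsto_re_LSeries_symmSqCoeff f).limUnder_eq

/-- **Shimura's identity as printed in [Watkins2004], §1** (for the naive symmetric square, every
level `N ≥ 1` and every parametrisation datum `D` of the tree, Manin constant `c = D.c`,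
`Ω = covol Λ_E = ZLattice.covolume D.L.lattice`):

  `L(Sym² E, 1)/(2πΩ) = deg φ/(N c²)`.

From `symmSqLOne_eq` (`L = 8π³(f,f)/N`) and Zagier's `deg · Ω = 4π² c² (f, f)`
(`zagier_degree_formula_holds`). For semistable `E` (no `U_p` factors) this is exactly the
displayed formula of §1; in general the paper's motivic `L(Sym² E, 1)` carries the extra factor
`∏_{p²∣N} U_p(1)`, absorbed here into the naive series. [cite: Watkins2004, §1 (first display); ZagierCMB1985, §1] -/
theorem ModularParametrizationData.symmSqLOne_div_eq {W : WeierstrassCurve ℚ}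
    (D : ModularParametrizationData W N) :
    symmSqLOne D.f / (2 * π * ZLattice.covolume D.L.lattice) =
      (D.modularDegree : ℝ) / (N * (D.c : ℝ) ^ 2) := by
  have hZ : 4 * π ^ 2 * (D.c : ℝ) ^ 2 * (peterssonProduct (Gamma0 N) 2 D.f D.f).re =
      (D.modularDegree : ℝ) * ZLattice.covolume D.L.lattice := by
    have h := congrArg Complex.re D.zagier_degree_formula_holds
    rw [Complex.re_ofReal_mul, Complex.ofReal_re] at h
    exact h
  have hcov : 0 < ZLattice.covolume D.L.lattice := ZLattice.covolume_pos D.L.lattice _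
  have hc0 : (D.c : ℝ) ≠ 0 := by exact_mod_cast D.maninConstant_ne_zero_holds
  have hNr : (N : ℝ) ≠ 0 := by exact_mod_cast NeZero.ne N
  have hπ : (π : ℝ) ≠ 0 := Real.pi_ne_zero
  rw [symmSqLOne_eq, div_eq_div_iff (by positivity) (by positivity)]
  have h1 : 8 * π ^ 3 * (peterssonProduct (Gamma0 N) 2 D.f D.f).re / N * (N * (D.c : ℝ) ^ 2) =
      8 * π ^ 3 * (D.c : ℝ) ^ 2 * (peterssonProduct (Gamma0 N) 2 D.f D.f).re := by
    field_simp
  rw [h1]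
  linear_combination (2 * π) * hZ

end Identities

end Literature.NumberTheory.EllipticCurves.ModularForms

/-! ### Watkins (2004), Theorem 5.1 from Lemma 3.4 verbatim -/

namespace Literature.NumberTheory.EllipticCurves

open Literature.NumberTheory.EllipticCurves.ModularForms

/-- **[Watkins2004], Theorem 5.1 as established by its printed proof, from Lemma 3.4 verbatim.**
Let `W/ℚ` be globally minimal with conductor `N ≥ 20000` and `D` a parametrisation datum at level
`N` with newform `f = D.f`. If Lemma 3.4 of the paper holds for this curve in the semistable form
used in the proof of Theorem 5.1 —

  `L(Sym² f_E, 1) ≥ 0.033/log N^{(2)}`, `N^{(2)} = N²`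

(with `L(Sym² f_E, 1) = symmSqLOne D.f`, the paper's normalisation; for semistable `E` the naive
and motivic symmetric squares agree) — then both inequalities of the corrected Theorem 5.1 hold:
`deg ≥ (N/(2π covol Λ_E)) · 0.033/(2 log N)` and `deg ≥ N^{7/6}/(5350 log N)`. Proof:
`(f, f) = N L/(8π³) ≥ 0.033 N/(16π³ log N)` (`symmSqLOne_eq`, `log N² = 2 log N`) and
`watkins2004_thm_5_1.corrected_of_petersson_lower_bound` (Zagier, `c² ≥ 1`, Lemma 2.1,
`N ≤ |Δ_min|`, arithmetic — all proved in the tree). What remains unproved of Theorem 5.1 is thus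
exactly Lemma 3.4 (explicit zero-free region, Lemmas 3.1–3.4) — and the `2π` of the printed first
inequality, see `first_of_symmSqLOne_lower_bound'`.
[cite: Watkins2004, Theorem 5.1 with §1, Lemma 2.1, Lemma 3.4, §4] -/
theorem watkins2004_thm_5_1.corrected_of_symmSqLOne_lower_bound
    (W : WeierstrassCurve ℚ) [W.IsElliptic] [W.IsGloballyMinimal] [NeZero (W.conductorNorm ℤ)]
    (hN : 20000 ≤ W.conductorNorm ℤ) (D : ModularParametrizationData W (W.conductorNorm ℤ))
    (hL : 0.033 / Real.log ((W.conductorNorm ℤ : ℝ) ^ 2) ≤ symmSqLOne D.f) :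
    (W.conductorNorm ℤ : ℝ) / (2 * Real.pi * ZLattice.covolume D.L.lattice) *
          (0.033 / (2 * Real.log (W.conductorNorm ℤ))) ≤ (D.modularDegree : ℝ) ∧
      (W.conductorNorm ℤ : ℝ) ^ (7 / 6 : ℝ) / (5350 * Real.log (W.conductorNorm ℤ)) ≤
        (D.modularDegree : ℝ) := by
  refine watkins2004_thm_5_1.corrected_of_petersson_lower_bound W hN D ?_
  have hN' : (20000 : ℝ) ≤ (W.conductorNorm ℤ : ℝ) := by exact_mod_cast hN
  have hN0 : (0 : ℝ) < (W.conductorNorm ℤ : ℝ) := by linarith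
  have hlog : 0 < Real.log (W.conductorNorm ℤ : ℝ) := Real.log_pos (by linarith)
  have hπ : (0 : ℝ) < π := Real.pi_pos
  rw [Real.log_pow, Nat.cast_ofNat, symmSqLOne_eq] at hL
  -- `hL : 0.033/(2 log N) ≤ 8π³ P/N`; multiply by `N/(8π³)`
  have key := mul_le_mul_of_nonneg_left hL
    (div_pos hN0 (by positivity : (0 : ℝ) < 8 * π ^ 3)).le
  calc 0.033 * (W.conductorNorm ℤ : ℝ) / (16 * π ^ 3 * Real.log (W.conductorNorm ℤ : ℝ))
      = (W.conductorNorm ℤ : ℝ) / (8 * π ^ 3) *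
          (0.033 / (2 * Real.log (W.conductorNorm ℤ : ℝ))) := by
        field_simp
        ring
    _ ≤ (W.conductorNorm ℤ : ℝ) / (8 * π ^ 3) *
          (8 * π ^ 3 * (peterssonProduct (Gamma0 (W.conductorNorm ℤ)) 2 D.f D.f).re /
            (W.conductorNorm ℤ : ℝ)) := key
    _ = (peterssonProduct (Gamma0 (W.conductorNorm ℤ)) 2 D.f D.f).re := by
        field_simp

/-- **What the first inequality of Theorem 5.1 AS PRINTED needs.** For any `W/ℚ`, level `N ≥ 2`
and datum `D`: the printed `deg ≥ (N/covol Λ) · 0.033/(2 log N)` (WITHOUT the `2π` of §1) follows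
from `c² · L(Sym² f_E, 1) ≥ 2π · 0.033/log N²` — by Shimura's identity
`deg = N c² L/(2π covol)` (`ModularParametrizationData.symmSqLOne_div_eq`) the two are equivalent —
i.e. from a symmetric-square bound `2π ≈ 6.28` times stronger than Lemma 3.4 (`0.2073…` in place
of `0.033`) when `c² = 1`. This records in the tree the size of the slip between §1/Lemma 3.4 and
the first display of §4 of the paper (its constants `2675 = ⌈2π·14.045/0.033⌉`, `5350 = 2·2675`
do contain the `2π`). [cite: Watkins2004, §1, Lemma 3.4, §4 (first display), Theorem 5.1] -/
theorem watkins2004_thm_5_1.first_of_symmSqLOne_lower_bound' {N : ℕ} [NeZero N]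
    {W : WeierstrassCurve ℚ} (hN : 2 ≤ N) (D : ModularParametrizationData W N)
    (hL : 2 * π * 0.033 / Real.log ((N : ℝ) ^ 2) ≤ (D.c : ℝ) ^ 2 * symmSqLOne D.f) :
    (N : ℝ) / ZLattice.covolume D.L.lattice * (0.033 / (2 * Real.log N)) ≤ (D.modularDegree : ℝ) := by
  have hcov : 0 < ZLattice.covolume D.L.lattice := ZLattice.covolume_pos D.L.lattice _
  have hN' : (2 : ℝ) ≤ (N : ℝ) := by exact_mod_cast hN
  have hN0 : (0 : ℝ) < N := by linarith
  have hlog : 0 < Real.log (N : ℝ) := Real.log_pos (by linarith)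
  have hπ : 0 < π := Real.pi_pos
  have hc0 : (D.c : ℝ) ≠ 0 := by exact_mod_cast D.maninConstant_ne_zero_holds
  -- Shimura: `L · (N c²) = deg · (2π covol)`
  have hZ' : symmSqLOne D.f * (N * (D.c : ℝ) ^ 2) =
      (D.modularDegree : ℝ) * (2 * π * ZLattice.covolume D.L.lattice) :=
    (div_eq_div_iff (by positivity) (by positivity)).mp (ModularParametrizationData.symmSqLOne_div_eq D)
  have hcL : (D.c : ℝ) ^ 2 * symmSqLOne D.f =
      2 * π * ZLattice.covolume D.L.lattice * (D.modularDegree : ℝ) / N := by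
    rw [eq_div_iff hN0.ne']
    linarith [hZ']
  rw [Real.log_pow, Nat.cast_ofNat, hcL, div_le_div_iff₀ (by positivity) hN0] at hL
  -- `hL : 2π · 0.033 · N ≤ (2π covol deg) · (2 log N)`
  rw [div_mul_div_comm, div_le_iff₀ (by positivity)]
  refine le_of_mul_le_mul_left (a := 2 * π) ?_ (by positivity)
  linarith [hL]

end Literature.NumberTheory.EllipticCurves

end
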